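import Summits.BirchSwinnertonDyer.BirchSwinnertonDyer.Theorems.AlignedTransportAtTwoMainConjectureTransportAlignedAtTwoKilfordCopyCongruenceLevel
import Summits.BirchSwinnertonDyer.BirchSwinnertonDyer.Theorems.AlignedTransportAtTwoMainConjectureTransportAlignedAtTwoDeltaPosCongruenceForms
import HarnessLib

/-!
# Crux C1 `MainConjectureTransportAlignedAtTwo` (stmt-BirchSwinnertonDyer-22296), line `birth`, residual (R2) `stub_lamLawKilford` (Kilford stratum):
# SAME DEPLETED COPY ⟹ THE `λ`-LAW, INSTANCE WITH THE CARRIER `ModularJacobianGaloisDataWithForms` (T1⁺) — the same-kernel hypothesis read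
# CARRIER-FREE on periods: `c₁·D_S·x(g₁)/2 ∈ Λ_{E₁} ↔ c₂·D_S·x(g₂)/2 ∈ Λ_{E₂}` for every cycle `x ∈ H₁(X₀(N');ℤ)`
# (width seat att-p3 g15; `--supports 22296`)

THEOREMS ONLY (no `def`, no `sorry`, no named fact). CONDITIONAL (hypotheses): `realPeriodRat_eq_unit_mul_plusPeriod_two` (PRINT); a carrier instance
`J' : ModularJacobianGaloisDataWithForms N' ι` (T1⁺, p669569; existence = the named fact `nonempty_modularJacobianGaloisDataWithForms`); data `D₁ D₂` at the
conductor levels with ODD Manin constants (T4; att-p4 g13 `…DeltaPosOddManin.exists_datum_odd_maninConstant` supplies them from PRINT); the `S`-depleted forms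
`g₁ g₂` at `N' = N₁N₂∏ℓ²` by `q`-expansion (existence: `…StarLevel.exists_depleted_eigenform_of_dvd`); and the SAME-DEPLETED-COPY hypothesis in PERIOD currency
`hkerU : ∀ x ∈ Λ_{N'}, u₁(c₁·D_S·x(g₁)/2) = O ↔ u₂(c₂·D_S·x(g₂)/2) = O` (no carrier needed to STATE it: «the half depleted period of `x` lies in the
Néron lattice of `E₁` iff it does for `E₂`»). NOT used: `heckeSelfDual_torsionBy_J0`, `buzzard2000_multiplicityOne_gamma0`, any stratum or sign hypothesis.
BSD is not proved by this; C1 is not closed by this; `stub_lamLawKilford` is NOT discharged by this.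

* **`lamLaw_of_forms_of_ker_iff`** — instance of this seat's `…KilfordCopyCongruenceLevel.lamLaw_of_abstractForms_of_ker_iff` with
  `Φᵢ := Dᵢ.jacobiMapForm N' (D_S•gᵢ)`, `gal := J'.galAct` (as in att-p3 g14's `…DeltaPosCongruenceForms.lamLawDeltaPos_of_forms`, p670839);
  ALL conductors, EITHER sign of `Δ(W₁)`; the conclusion of `stub_lamLawKilford` VERBATIM.
READING: (R2) ⟸ PRINT (period unit) + T1⁺ + T4 + «`AlignedAtTwo` ⟹ `hkerU`» — the last is the cross-level form of the cell's `F1Sign2.CopyAlignmentAtTwo`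
(same DEPLETED copies; census MEMO-imc §10.21 (c′) 770/770), the one research input left on this road.

References: Greenberg–Vatsal 2000 Thm. (1.4) and §3; Emerton–Pollack–Weston 2006 §3; Darmon–Diamond–Taylor 1995 §1.5–§1.7; Kilford–Wiese 2008 Question 1.9;
Atkin–Lehner 1970 §3; Matsuno 2008 Thm. 4.2.
-/

noncomputable section

-- justification: the `Summit.BirchSwinnertonDyer.BirchSwinnertonDyer.…` path repeats a component (route-file convention)
set_option linter.dupNamespace false
set_option autoImplicit false

open scoped MatrixGroups ModularForm NumberField Classical
open CongruenceSubgroup Complex WeierstrassCurve IsDedekindDomain Polynomial Module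
open Literature.NumberTheory.EllipticCurves Literature.NumberTheory.EllipticCurves.ModularForms
open Literature.NumberTheory.EllipticCurves.Greenberg1999 Literature.NumberTheory.EllipticCurves.GreenbergVatsal2000
open Summit.BirchSwinnertonDyer.Rank1Residual.F1Sign2 Summit.BirchSwinnertonDyer.Rank1Residual.X1.MuLambda
open Summit.BirchSwinnertonDyer.BirchSwinnertonDyer.Theorems.AlignedTransportAtTwoClosure
open Summit.BirchSwinnertonDyer.BirchSwinnertonDyer.Theorems.ThetaLayerLambdaCongruenceAtTwo
open Summit.BirchSwinnertonDyer.BirchSwinnertonDyer.Theorems.AlignedTransportAtTwoDeltaPosFunctionalDepleted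
open Summit.BirchSwinnertonDyer.BirchSwinnertonDyer.Theorems.AlignedTransportAtTwoDeltaPosCongruenceForms
open Summit.BirchSwinnertonDyer.BirchSwinnertonDyer.Theorems.AlignedTransportAtTwoKilfordCopyCongruenceLevel

namespace Summit.BirchSwinnertonDyer.BirchSwinnertonDyer.Theorems.AlignedTransportAtTwoKilfordCopyCongruenceForms

/-- **SAME DEPLETED COPY ⟹ the `λ`-law, instance with the carrier with forms.** Binders of `stub_lamLawKilford` (the used ones) + PRINT (`hΩu`) + T4
(`D₁ D₂` at the conductor levels, odd `cᵢ`) + T1⁺ (`J'` at `N' = N₁N₂·∏_{ℓ∣N₁N₂ odd}ℓ²`) + the `S`-depleted forms `g₁ g₂` (by `q`-expansion) + the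
same-depleted-copy hypothesis in period currency `hkerU` ⟹ the conclusion of `stub_lamLawKilford` VERBATIM; all conductors, either sign of `Δ(W₁)`.
[cite: GreenbergVatsal2000, Thm. (1.4) and §3] [cite: DarmonDiamondTaylor1995, §1.5 and §1.7] [cite: KilfordWiese2008, Question 1.9] [cite: AtkinLehner1970, §3] -/
theorem lamLaw_of_forms_of_ker_iff
    (hΩu : realPeriodRat_eq_unit_mul_plusPeriod_two)
    (W₁ : WeierstrassCurve ℚ) [W₁.IsElliptic] [W₁.IsGloballyMinimal]
    (W₂ : WeierstrassCurve ℚ) [W₂.IsElliptic] [W₂.IsGloballyMinimal]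
    (hord₁ : IsOrdinaryAt W₁ 2) (hord₂ : IsOrdinaryAt W₂ 2)
    (ht₁ : ∀ x : ℚ, ¬ HasRationalTwoTorsionX W₁ x) (ht₂ : ∀ x : ℚ, ¬ HasRationalTwoTorsionX W₂ x)
    (hsq₂ : ¬ IsSquare W₂.Δ)
    {F : Type} [Field F] [NumberField F] (hF : finrank ℚ F = 3)
    {e₁ e₂ : F} (he₁ : aeval e₁ (twoDivisionUCubic W₁) = 0) (he₂ : aeval e₂ (twoDivisionUCubic W₂) = 0)
    (hal : AlignedAtInfinity F (twoDivisionUCubic W₁) (twoDivisionUCubic W₂) e₁ e₂)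
    [NeZero (W₁.conductorNorm ℤ)] [NeZero (W₂.conductorNorm ℤ)]
    {f₁ : CuspForm (Gamma0 (W₁.conductorNorm ℤ)) 2} (hf₁ : IsNewformOf W₁ f₁)
    {f₂ : CuspForm (Gamma0 (W₂.conductorNorm ℤ)) 2} (hf₂ : IsNewformOf W₂ f₂)
    {G₁ G₂ : IwasawaAlgebra 2} (hG₁ : IsEvenBranchLiftAtTwo W₁ f₁ G₁) (hG₂ : IsEvenBranchLiftAtTwo W₂ f₂ G₂)
    (D₁ : ModularParametrizationData W₁ (W₁.conductorNorm ℤ)) (D₂ : ModularParametrizationData W₂ (W₂.conductorNorm ℤ))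
    (hc₁ : Odd D₁.c) (hc₂ : Odd D₂.c)
    (ι : AlgebraicClosure ℚ →+* ℂ) (N' : ℕ) [NeZero N']
    (hN' : N' = W₁.conductorNorm ℤ * W₂.conductorNorm ℤ *
      ∏ ℓ ∈ (W₁.conductorNorm ℤ * W₂.conductorNorm ℤ).primeFactors.erase 2, ℓ ^ 2)
    (J' : ModularJacobianGaloisDataWithForms N' ι)
    -- the depleted forms by `q`-expansion
    (g₁ g₂ : CuspForm (Gamma0 N') 2)
    (hg₁ : ∀ n : ℕ, cuspCoeff g₁ n =
      if ∃ ℓ ∈ (W₁.conductorNorm ℤ * W₂.conductorNorm ℤ).primeFactors.erase 2, ℓ ∣ n then 0 else cuspCoeff f₁ n)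
    (hg₂ : ∀ n : ℕ, cuspCoeff g₂ n =
      if ∃ ℓ ∈ (W₁.conductorNorm ℤ * W₂.conductorNorm ℤ).primeFactors.erase 2, ℓ ∣ n then 0 else cuspCoeff f₂ n)
    -- SAME DEPLETED COPY, period currency
    (hkerU : ∀ x ∈ periodHomology N',
      D₁.uniformize ((D₁.c : ℂ) *
          ((((∏ ℓ ∈ (W₁.conductorNorm ℤ * W₂.conductorNorm ℤ).primeFactors.erase 2, ℓ ^ 2 : ℕ) : ℂ) * x g₁) / 2)) = 0 ↔
        D₂.uniformize ((D₂.c : ℂ) *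
          ((((∏ ℓ ∈ (W₁.conductorNorm ℤ * W₂.conductorNorm ℤ).primeFactors.erase 2, ℓ ^ 2 : ℕ) : ℂ) * x g₂) / 2)) = 0) :
    lam G₁ + ∑ ℓ ∈ (W₁.conductorNorm ℤ * W₂.conductorNorm ℤ).primeFactors.erase 2, lambdaCorrectionAtTwo W₁ ℓ =
      lam G₂ + ∑ ℓ ∈ (W₁.conductorNorm ℤ * W₂.conductorNorm ℤ).primeFactors.erase 2, lambdaCorrectionAtTwo W₂ ℓ := by
  -- §0 the depleted level and its prime support
  have hN₁0 : W₁.conductorNorm ℤ ≠ 0 := NeZero.ne _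
  have hN₂0 : W₂.conductorNorm ℤ ≠ 0 := NeZero.ne _
  set M : ℕ := W₁.conductorNorm ℤ * W₂.conductorNorm ℤ with hM
  set SS : Finset ℕ := M.primeFactors.erase 2 with hSS
  have hSSp : ∀ ℓ ∈ SS, ℓ.Prime := fun ℓ hℓ ↦ Nat.prime_of_mem_primeFactors (Finset.mem_of_mem_erase hℓ)
  have hNL₁ : W₁.conductorNorm ℤ * ∏ ℓ ∈ SS, ℓ ^ 2 ∣ N' := ⟨W₂.conductorNorm ℤ, by rw [hN', hM]; ring⟩
  have hNL₂ : W₂.conductorNorm ℤ * ∏ ℓ ∈ SS, ℓ ^ 2 ∣ N' := ⟨W₁.conductorNorm ℤ, by rw [hN', hM]; ring⟩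
  -- §1 `q`-expansions against the data's newforms
  have hfD₁ : D₁.f = f₁ := eq_of_forall_cuspCoeff_eq_gamma0 fun n ↦ by rw [D₁.isNewformOf.2 n, hf₁.2 n]
  have hfD₂ : D₂.f = f₂ := eq_of_forall_cuspCoeff_eq_gamma0 fun n ↦ by rw [D₂.isNewformOf.2 n, hf₂.2 n]
  have hg₁D : ∀ n : ℕ, cuspCoeff g₁ n = if ∃ ℓ ∈ SS, ℓ ∣ n then 0 else cuspCoeff D₁.f n := fun n ↦ by rw [hg₁ n, hfD₁]
  have hg₂D : ∀ n : ℕ, cuspCoeff g₂ n = if ∃ ℓ ∈ SS, ℓ ∣ n then 0 else cuspCoeff D₂.f n := fun n ↦ by rw [hg₂ n, hfD₂]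
  -- §2 the forms `D_S • gᵢ`: rational `q`-expansions and lattice compatibility
  set DS : ℂ := ((∏ ℓ ∈ SS, ℓ ^ 2 : ℕ) : ℂ) with hDS
  have hrat : ∀ {N₀ : ℕ} [NeZero N₀] {f : CuspForm (Gamma0 N₀) 2} {W : WeierstrassCurve ℚ} (_ : IsNewformOf W f)
      (g : CuspForm (Gamma0 N') 2)
      (_ : ∀ n : ℕ, cuspCoeff g n = if ∃ ℓ ∈ SS, ℓ ∣ n then 0 else cuspCoeff f n) (n : ℕ),
      ∃ q : ℚ, cuspCoeff (DS • g) n = (q : ℂ) := by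
    intro N₀ _ f W hf g hg n
    rw [cuspCoeff_smul_gamma0, hg n]
    split_ifs
    · exact ⟨0, by simp⟩
    · refine ⟨(∏ ℓ ∈ SS, ℓ ^ 2 : ℕ) * W.LFunction n, ?_⟩
      rw [hf.2 n, hDS]; push_cast; ring
  have hlat₁ : ∀ φ ∈ periodHomology N', (D₁.c : ℂ) * φ (DS • g₁) ∈ D₁.L.lattice := fun φ hφ ↦ by
    rw [map_smul, smul_eq_mul]
    exact maninConstant_mul_prodSq_mul_eval_depleted_mem D₁ SS hSSp N' hNL₁ g₁ hg₁D hφ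
  have hlat₂ : ∀ φ ∈ periodHomology N', (D₂.c : ℂ) * φ (DS • g₂) ∈ D₂.L.lattice := fun φ hφ ↦ by
    rw [map_smul, smul_eq_mul]
    exact maninConstant_mul_prodSq_mul_eval_depleted_mem D₂ SS hSSp N' hNL₂ g₂ hg₂D hφ
  -- §3 the same-kernel hypothesis in the carrier's currency
  have hΦhalf : ∀ {W : WeierstrassCurve ℚ} {N₀ : ℕ} [NeZero N₀] (D : ModularParametrizationData W N₀) (g : CuspForm (Gamma0 N') 2)
      (hlat : ∀ φ ∈ periodHomology N', (D.c : ℂ) * φ (DS • g) ∈ D.L.lattice) (x : Module.Dual ℂ (CuspForm (Gamma0 N') 2)),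
      D.jacobiMapForm N' (DS • g) hlat (Submodule.Quotient.mk ((2 : ℂ)⁻¹ • x)) = D.uniformize ((D.c : ℂ) * ((DS * x g) / 2)) := by
    intro W N₀ _ D g hlat x
    rw [ModularParametrizationData.jacobiMapForm_mk, map_smul, smul_eq_mul, LinearMap.smul_apply, smul_eq_mul]
    congr 1; ring
  have hker : ∀ x ∈ periodHomology N',
      D₁.jacobiMapForm N' (DS • g₁) hlat₁ (Submodule.Quotient.mk ((2 : ℂ)⁻¹ • x)) = 0 ↔
        D₂.jacobiMapForm N' (DS • g₂) hlat₂ (Submodule.Quotient.mk ((2 : ℂ)⁻¹ • x)) = 0 := by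
    intro x hx
    rw [hΦhalf D₁ g₁ hlat₁ x, hΦhalf D₂ g₂ hlat₂ x]
    exact hkerU x hx
  -- §4 the carrier's Jacobi maps and Galois action
  refine lamLaw_of_abstractForms_of_ker_iff hΩu W₁ W₂ hord₁ hord₂ ht₁ ht₂ hsq₂ hF he₁ he₂ hal hf₁ hf₂ hG₁ hG₂
    D₁ D₂ hc₁ hc₂ SS hSS N' hN' g₁ g₂ hg₁ hg₂ ι
    (D₁.jacobiMapForm N' (DS • g₁) hlat₁) (D₂.jacobiMapForm N' (DS • g₂) hlat₂)
    (fun y ↦ by rw [ModularParametrizationData.jacobiMapForm_mk, map_smul, smul_eq_mul])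
    (fun y ↦ by rw [ModularParametrizationData.jacobiMapForm_mk, map_smul, smul_eq_mul])
    (fun σ ↦ (J'.galAct σ).toLinearMap.toAddMonoidHom) (fun σ y P h ↦ ?_) (fun σ y P h ↦ ?_) hker
  · exact J'.jacobiMapForm_galAct W₁ _ D₁ (DS • g₁) (hrat hf₁ g₁ hg₁) hlat₁ σ y P h
  · exact J'.jacobiMapForm_galAct W₂ _ D₂ (DS • g₂) (hrat hf₂ g₂ hg₂) hlat₂ σ y P h

end Summit.BirchSwinnertonDyer.BirchSwinnertonDyer.Theorems.AlignedTransportAtTwoKilfordCopyCongruenceForms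

end
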